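import Summits.ResolutionOfSingularities.ResolutionOfSingularities.Theorems.FrobeniusClosingSteerBetaPolygonCohenCoordinates
import Literature.RingTheory.CompleteLocalRings.CoefficientFieldCharP
import Literature.RingTheory.MvPowerSeries.MaximalIdealPow
import HarnessLib

/-!
# Crux `Steer` (stmt-ResolutionOfSingularities-16345), chain W4.1 — CONE PERSISTENCE along an x-chart letter, part 1/3:
# the coefficient field and the chart map in Cohen coordinates; coefficient calculus in `κ₁⟦X₀..X₃⟧`

OURS (campaign `res-hironaka`, rung L ★L-G4, slot W4.1; seat res-L0-w41-stub-4 g7 on res-L0-w41-plan-1 RULINGS 196d/207(a) — «CONTINUE the cone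
lemmas … `conePersistenceX_holds` is YOURS»). Replaces the role of no printed item; NOT a statement of the manuscript under review
[claim: Hironaka2017, status: under-review]; AI-produced, weaker than expert review. Theses-free, definition-free, WORDS-FREE.

THE COMPUTATION (parts 1–3). Along an x-chart letter `φ : S → S₁` in section form, read everything in Cohen coordinates
`e₁ : S₁ ≃ κ₁⟦X₀,X₁,X₂,X₃⟧` adapted to the r.s.o.p. `(x₁, v₁, z₁, w₁)`: `σ₁` becomes the constants (uniqueness of the coefficient field), `φ(S)`
lands in `κ₁ + X₀·κ₁⟦X⟧`, `φ(𝔪_S^n)` in `X₀^n·(series whose X₀-free monomials have (X₂,X₃)-degree ≤ n)`; extracting the coefficients of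
`X₀^(a+b+d) X₁^(b₁) X₂^i X₃^j` on both sides of the radicand relation `φ(u)·φ(f) = x₁^(2k)·u₁ f₁` gives `Ψ̄₁ = λ·(Ψ̄ ⊗_ī κ₁)`, `λ ∈ κ₁ˣ`.
This part:
* `ringEquiv_section_eq_C` — a Cohen coordinate system carries THE coefficient field to the constants (perfect residue field, char `p`;
  tree `ringHom_eq_of_comp_residue_eq_id_of_perfectField`).
* `map_maximalIdeal_le_span_of_chart`, `exists_eq_section_add_mul_of_chart`, `exists_eq_C_add_X_mul_of_chart` — `φ s = σ₁(ī s̄) + x₁·g`.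
* §3 `coeff_X_pow_mul_eq`, `coeff_X_mul_eq`, `coeff_C_add_X_mul_eq`, `coeff_X_zero_mul_of_apply_eq_zero`; the `(X₂,X₃)`-DEGREE BOUND off `X₀`
  and its closure rules `degBound_mul/add/mono/C/X_zero_mul/C_add_X_one/X_two_three`, `inv_mul_of_C_add(_one)`, `inv_mul_inv`.
* §4 `eval_sub_sum_mem_pow` (a `d`-form modulo `𝔪^(d+1)` only sees the residues of its coefficients), `coeff_sum_C_mul_X_pow(_of_ne)`,
  `degBound_sum_C_mul_X_pow`.

[cite: Matsumura1987, Thm. 28.3] [folklore]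
bears_on: LADDER-RESOLUTION L ★L-G4 W4.1 (crux `Steer`, binder hK4ⁿᶜ, β-slots `HatBaseChangeX` / `ConePersistenceX`).
-/

noncomputable section

-- `Summit.<S>.<S>.…` duplicates the summit name by design (single-problem summit).
set_option linter.dupNamespace false

open MvPowerSeries IsLocalRing
open Literature.RingTheory.CompleteLocalRings

namespace Summit.ResolutionOfSingularities.ResolutionOfSingularities.Theorems.SwitchingDichotomy.HatBaseChange

/-! ## §1 The coefficient field in Cohen coordinates -/

section CoeffField
variable {A : Type} [CommRing A] [IsLocalRing A] [IsAdicComplete (maximalIdeal A) A] {ι : Type}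

/-- **A Cohen coordinate system carries THE coefficient field to the constants** (perfect residue field, prime characteristic). -/
theorem ringEquiv_section_eq_C (p : ℕ) (hp : p.Prime) [CharP A p] [PerfectField (ResidueField A)]
    (e : A ≃+* MvPowerSeries ι (ResidueField A)) (he : ∀ a, constantCoeff (e a) = residue A a)
    (σ : ResidueField A →+* A) (hσ : ∀ b, residue A (σ b) = b) (b : ResidueField A) :
    e (σ b) = C b := by
  -- `τ := e⁻¹ ∘ C` is another section of `residue`, hence `τ = σ`
  let τ : ResidueField A →+* A := e.symm.toRingHom.comp (C (σ := ι) (R := ResidueField A))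
  have hτ : ∀ b, residue A (τ b) = b := fun b => by
    change residue A (e.symm (C b)) = b
    rw [← he, RingEquiv.apply_symm_apply, constantCoeff_C]
  have hτσ : τ = σ := ringHom_eq_of_comp_residue_eq_id_of_perfectField p hp τ σ hτ hσ
  have : e (τ b) = C b := by
    change e (e.symm (C b)) = C b
    exact RingEquiv.apply_symm_apply _ _
  rwa [hτσ] at this

end CoeffField

/-! ## §2 The chart map in Cohen coordinates of the target -/

section ChartCohen
variable {S S₁ : Type} [CommRing S] [IsLocalRing S] [CommRing S₁] [IsLocalRing S₁]
  (φ : S →+* S₁) (σ : ResidueField S →+* S) (σ₁ : ResidueField S₁ →+* S₁) (x y z w : S) (c : ResidueField S₁) (v₁ z₁ w₁ : S₁)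

/-- Along an x-chart, `φ` maps the maximal ideal of `S` into `x₁·S₁` (`x₁ = φ x`). -/
theorem map_maximalIdeal_le_span_of_chart (hspan : Ideal.span {x, y, z, w} = maximalIdeal S)
    (hy : φ y = φ x * (σ₁ c + v₁)) (hz : φ z = φ x * z₁) (hw : φ w = φ x * w₁) :
    (maximalIdeal S).map φ ≤ Ideal.span {φ x} := by
  rw [← hspan, Ideal.map_span, Ideal.span_le]
  rintro _ ⟨s, hs, rfl⟩
  simp only [Set.mem_insert_iff, Set.mem_singleton_iff] at hs
  rcases hs with rfl | rfl | rfl | rfl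
  · exact Ideal.subset_span rfl
  · rw [hy]; exact Ideal.mul_mem_right _ _ (Ideal.subset_span rfl)
  · rw [hz]; exact Ideal.mul_mem_right _ _ (Ideal.subset_span rfl)
  · rw [hw]; exact Ideal.mul_mem_right _ _ (Ideal.subset_span rfl)

/-- **`φ s = σ₁ (ī s̄) + x₁·g`**: along an x-chart with compatible coefficient fields, every element of `φ S` is a coefficient-field constant
plus a multiple of `x₁`. -/
theorem exists_eq_section_add_mul_of_chart (hσ : ∀ a, residue S (σ a) = a)
    (hcompat : ∀ a, φ (σ a) = σ₁ (residue S₁ (φ (σ a))))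
    (hspan : Ideal.span {x, y, z, w} = maximalIdeal S)
    (hy : φ y = φ x * (σ₁ c + v₁)) (hz : φ z = φ x * z₁) (hw : φ w = φ x * w₁) (s : S) :
    ∃ g : S₁, φ s = σ₁ (residue S₁ (φ (σ (residue S s)))) + φ x * g := by
  have hmem : s - σ (residue S s) ∈ maximalIdeal S := by
    rw [← IsLocalRing.residue_eq_zero_iff, map_sub, hσ, sub_self]
  have h := map_maximalIdeal_le_span_of_chart φ σ₁ x y z w c v₁ z₁ w₁ hspan hy hz hw (Ideal.mem_map_of_mem φ hmem)
  obtain ⟨g, hg⟩ := Ideal.mem_span_singleton'.mp h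
  refine ⟨g, ?_⟩
  rw [← hcompat, mul_comm, hg, map_sub, add_sub_cancel]

/-- **The chart map in Cohen coordinates of `S₁`**: `e₁ (φ s) = C (ī s̄) + X₀ · G`. -/
theorem exists_eq_C_add_X_mul_of_chart (p : ℕ) (hp : p.Prime) [CharP S₁ p] [IsAdicComplete (maximalIdeal S₁) S₁]
    [PerfectField (ResidueField S₁)]
    (e₁ : S₁ ≃+* MvPowerSeries (Fin 4) (ResidueField S₁)) (he₁ : ∀ a, constantCoeff (e₁ a) = residue S₁ a) (hex : e₁ (φ x) = X 0)
    (hσ : ∀ a, residue S (σ a) = a) (hσ₁ : ∀ b, residue S₁ (σ₁ b) = b)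
    (hcompat : ∀ a, φ (σ a) = σ₁ (residue S₁ (φ (σ a))))
    (hspan : Ideal.span {x, y, z, w} = maximalIdeal S)
    (hy : φ y = φ x * (σ₁ c + v₁)) (hz : φ z = φ x * z₁) (hw : φ w = φ x * w₁) (s : S) :
    ∃ G : MvPowerSeries (Fin 4) (ResidueField S₁), e₁ (φ s) = C (residue S₁ (φ (σ (residue S s)))) + X 0 * G := by
  obtain ⟨g, hg⟩ := exists_eq_section_add_mul_of_chart φ σ σ₁ x y z w c v₁ z₁ w₁ hσ hcompat hspan hy hz hw s
  refine ⟨e₁ g, ?_⟩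
  rw [hg, map_add, map_mul, hex, ringEquiv_section_eq_C p hp e₁ he₁ σ₁ hσ₁]

end ChartCohen


/-! ## §3 Coefficient calculus in `κ₁⟦X₀, X₁, X₂, X₃⟧`: shifted coefficients and the `(X₂,X₃)`-degree bound off `X₀` -/

section ConeCoeff
variable {k : Type} [Field k]

/-- Coefficients of `X_s^n · G`. -/
theorem coeff_X_pow_mul_eq (s : Fin 4) (n : ℕ) (m : Fin 4 →₀ ℕ) (G : MvPowerSeries (Fin 4) k) :
    coeff m (X s ^ n * G) = if n ≤ m s then coeff (m - Finsupp.single s n) G else 0 := by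
  rw [X_pow_eq, coeff_monomial_mul, one_mul]
  by_cases h : n ≤ m s
  · rw [if_pos h, if_pos (Finsupp.single_le_iff.mpr h)]
  · rw [if_neg h, if_neg (fun h' => h (Finsupp.single_le_iff.mp h'))]

/-- Coefficients of `X_s · G`. -/
theorem coeff_X_mul_eq (s : Fin 4) (m : Fin 4 →₀ ℕ) (G : MvPowerSeries (Fin 4) k) :
    coeff m (X s * G) = if 1 ≤ m s then coeff (m - Finsupp.single s 1) G else 0 := by
  rw [← pow_one (X s), coeff_X_pow_mul_eq]

/-- Coefficients of `(C c + X₁) · G`. -/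
theorem coeff_C_add_X_mul_eq (c : k) (m : Fin 4 →₀ ℕ) (G : MvPowerSeries (Fin 4) k) :
    coeff m ((C c + X 1) * G) = c * coeff m G + if 1 ≤ m 1 then coeff (m - Finsupp.single 1 1) G else 0 := by
  rw [add_mul, map_add, coeff_C_mul, coeff_X_mul_eq]

/-- A coefficient of `X₀ · H` off `X₀` vanishes. -/
theorem coeff_X_zero_mul_of_apply_eq_zero (m : Fin 4 →₀ ℕ) (hm : m 0 = 0) (H : MvPowerSeries (Fin 4) k) :
    coeff m (X 0 * H) = 0 := by
  rw [coeff_X_mul_eq, if_neg (by omega)]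

/-- **Product rule for the `(X₂,X₃)`-degree bound off `X₀`**: if the `X₀`-free monomials of `G` (resp. `T`) have `(X₂,X₃)`-degree `≤ n`
(resp. `≤ n'`), those of `G·T` have `(X₂,X₃)`-degree `≤ n + n'`. -/
theorem degBound_mul {n n' : ℕ} {G T : MvPowerSeries (Fin 4) k}
    (hG : ∀ m : Fin 4 →₀ ℕ, m 0 = 0 → coeff m G ≠ 0 → m 2 + m 3 ≤ n)
    (hT : ∀ m : Fin 4 →₀ ℕ, m 0 = 0 → coeff m T ≠ 0 → m 2 + m 3 ≤ n') :
    ∀ m : Fin 4 →₀ ℕ, m 0 = 0 → coeff m (G * T) ≠ 0 → m 2 + m 3 ≤ n + n' := by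
  classical
  intro m hm0 hne
  rw [coeff_mul] at hne
  obtain ⟨pq, hpq, hterm⟩ := Finset.exists_ne_zero_of_sum_ne_zero hne
  have hsum : pq.1 + pq.2 = m := Finset.HasAntidiagonal.mem_antidiagonal.mp hpq
  have h1 : pq.1 0 = 0 := by have := congrArg (fun f => f 0) hsum; simp only [Finsupp.coe_add, Pi.add_apply] at this; omega
  have h2 : pq.2 0 = 0 := by have := congrArg (fun f => f 0) hsum; simp only [Finsupp.coe_add, Pi.add_apply] at this; omega
  have hb1 := hG pq.1 h1 (left_ne_zero_of_mul hterm)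
  have hb2 := hT pq.2 h2 (right_ne_zero_of_mul hterm)
  have e2 := congrArg (fun f => f 2) hsum
  have e3 := congrArg (fun f => f 3) hsum
  simp only [Finsupp.coe_add, Pi.add_apply] at e2 e3
  omega

/-- Sum rule for the degree bound. -/
theorem degBound_add {n : ℕ} {G T : MvPowerSeries (Fin 4) k}
    (hG : ∀ m : Fin 4 →₀ ℕ, m 0 = 0 → coeff m G ≠ 0 → m 2 + m 3 ≤ n)
    (hT : ∀ m : Fin 4 →₀ ℕ, m 0 = 0 → coeff m T ≠ 0 → m 2 + m 3 ≤ n) :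
    ∀ m : Fin 4 →₀ ℕ, m 0 = 0 → coeff m (G + T) ≠ 0 → m 2 + m 3 ≤ n := by
  intro m hm0 hne
  rw [map_add] at hne
  by_cases hG0 : coeff m G = 0
  · rw [hG0, zero_add] at hne; exact hT m hm0 hne
  · exact hG m hm0 hG0

/-- Monotonicity of the degree bound. -/
theorem degBound_mono {n n' : ℕ} (h : n ≤ n') {G : MvPowerSeries (Fin 4) k}
    (hG : ∀ m : Fin 4 →₀ ℕ, m 0 = 0 → coeff m G ≠ 0 → m 2 + m 3 ≤ n) :
    ∀ m : Fin 4 →₀ ℕ, m 0 = 0 → coeff m G ≠ 0 → m 2 + m 3 ≤ n' :=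
  fun m hm hne => (hG m hm hne).trans h

/-- Constants have degree bound `0`. -/
theorem degBound_C (c : k) (n : ℕ) : ∀ m : Fin 4 →₀ ℕ, m 0 = 0 → coeff m (C c : MvPowerSeries (Fin 4) k) ≠ 0 → m 2 + m 3 ≤ n := by
  classical
  intro m _ hne
  rw [coeff_C] at hne
  by_cases h : m = 0
  · simp [h]
  · exact absurd (if_neg h) hne

/-- Multiples of `X₀` have every degree bound (no `X₀`-free monomials). -/
theorem degBound_X_zero_mul (H : MvPowerSeries (Fin 4) k) (n : ℕ) :
    ∀ m : Fin 4 →₀ ℕ, m 0 = 0 → coeff m (X 0 * H) ≠ 0 → m 2 + m 3 ≤ n :=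
  fun m hm hne => absurd (coeff_X_zero_mul_of_apply_eq_zero m hm H) hne

/-- `C c + X₁` has degree bound `0`. -/
theorem degBound_C_add_X_one (c : k) (n : ℕ) :
    ∀ m : Fin 4 →₀ ℕ, m 0 = 0 → coeff m (C c + X 1 : MvPowerSeries (Fin 4) k) ≠ 0 → m 2 + m 3 ≤ n := by
  classical
  refine degBound_mono (Nat.zero_le n) (degBound_add (degBound_C c 0) ?_)
  intro m _ hne
  rw [coeff_X] at hne
  by_cases h : m = Finsupp.single 1 1
  · subst h; simp
  · exact absurd (if_neg h) hne

/-- `X₂` and `X₃` have degree bound `1`. -/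
theorem degBound_X_two_three (s : Fin 4) (hs : s = 2 ∨ s = 3) :
    ∀ m : Fin 4 →₀ ℕ, m 0 = 0 → coeff m (X s : MvPowerSeries (Fin 4) k) ≠ 0 → m 2 + m 3 ≤ 1 := by
  classical
  intro m _ hne
  rw [coeff_X] at hne
  by_cases h : m = Finsupp.single s 1
  · subst h; rcases hs with rfl | rfl <;> simp
  · exact absurd (if_neg h) hne

/-- **Elements of the form `C α + X₀·H` preserve `X₀^n·(degree ≤ n)`** (this is how `φ(S)` acts). -/
theorem inv_mul_of_C_add (n b : ℕ) (α : k) (H G' : MvPowerSeries (Fin 4) k)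
    (hG : ∀ m : Fin 4 →₀ ℕ, m 0 = 0 → coeff m G' ≠ 0 → m 2 + m 3 ≤ b) :
    ∃ G'' : MvPowerSeries (Fin 4) k, (C α + X 0 * H) * (X 0 ^ n * G') = X 0 ^ n * G'' ∧
      ∀ m : Fin 4 →₀ ℕ, m 0 = 0 → coeff m G'' ≠ 0 → m 2 + m 3 ≤ b := by
  refine ⟨C α * G' + X 0 * (H * G'), by ring, degBound_add ?_ (degBound_X_zero_mul _ b)⟩
  simpa using degBound_mul (degBound_C α 0) hG

/-- The same with a single `X₀`. -/
theorem inv_mul_of_C_add_one (b : ℕ) (α : k) (H G' : MvPowerSeries (Fin 4) k)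
    (hG : ∀ m : Fin 4 →₀ ℕ, m 0 = 0 → coeff m G' ≠ 0 → m 2 + m 3 ≤ b) :
    ∃ G'' : MvPowerSeries (Fin 4) k, (C α + X 0 * H) * (X 0 * G') = X 0 * G'' ∧
      ∀ m : Fin 4 →₀ ℕ, m 0 = 0 → coeff m G'' ≠ 0 → m 2 + m 3 ≤ b := by
  obtain ⟨G'', h, hd⟩ := inv_mul_of_C_add 1 b α H G' hG
  exact ⟨G'', by simpa using h, hd⟩

/-- Products: `X₀^n·(≤ n)` times `X₀^n'·(≤ n')` is `X₀^(n+n')·(≤ n+n')`. -/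
theorem inv_mul_inv {n n' : ℕ} (G' T' : MvPowerSeries (Fin 4) k)
    (hG : ∀ m : Fin 4 →₀ ℕ, m 0 = 0 → coeff m G' ≠ 0 → m 2 + m 3 ≤ n)
    (hT : ∀ m : Fin 4 →₀ ℕ, m 0 = 0 → coeff m T' ≠ 0 → m 2 + m 3 ≤ n') :
    (X 0 ^ n * G') * (X 0 ^ n' * T') = X 0 ^ (n + n') * (G' * T') ∧
      ∀ m : Fin 4 →₀ ℕ, m 0 = 0 → coeff m (G' * T') ≠ 0 → m 2 + m 3 ≤ n + n' :=
  ⟨by ring, degBound_mul hG hT⟩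

end ConeCoeff


/-! ## §4 Binary forms: replacing coefficients by their coefficient-field representatives; reading pure `(X₂,X₃)`-coefficients -/

section Forms
variable {A : Type} [CommRing A] [IsLocalRing A]

/-- **A binary form modulo `𝔪^(d+1)` only sees the RESIDUES of its coefficients**: replacing each coefficient of a degree-`d` form by any
representative of the same residue class changes `Ψ(z, w)` (`z, w ∈ 𝔪`) by an element of `𝔪^(d+1)`. -/
theorem eval_sub_sum_mem_pow (d : ℕ) (Ψ : MvPolynomial (Fin 2) A) (hΨ : Ψ.IsHomogeneous d) (z w : A)
    (hz : z ∈ maximalIdeal A) (hw : w ∈ maximalIdeal A) (c' : (Fin 2 →₀ ℕ) → A)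
    (hc' : ∀ e, c' e - MvPolynomial.coeff e Ψ ∈ maximalIdeal A) :
    MvPolynomial.eval ![z, w] Ψ - ∑ e ∈ Ψ.support, c' e * (z ^ (e 0) * w ^ (e 1)) ∈ maximalIdeal A ^ (d + 1) := by
  rw [MvPolynomial.eval_eq', ← Finset.sum_sub_distrib]
  refine Ideal.sum_mem _ fun e he => ?_
  simp only [Fin.prod_univ_two, Matrix.cons_val_zero, Matrix.cons_val_one]
  rw [← sub_mul, pow_succ', show MvPolynomial.coeff e Ψ - c' e = -(c' e - MvPolynomial.coeff e Ψ) by ring, neg_mul]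
  refine neg_mem (Ideal.mul_mem_mul (hc' e) ?_)
  have hdeg : e 0 + e 1 = d := by
    have := hΨ (MvPolynomial.mem_support_iff.mp he)
    rw [← this, Finsupp.weight_apply]  -- degree of e
    simp [Finsupp.sum_fintype, Fin.sum_univ_two]
  rw [← hdeg, pow_add]
  exact Ideal.mul_mem_mul (Ideal.pow_mem_pow hz _) (Ideal.pow_mem_pow hw _)

end Forms

section PureCoeff
variable {k : Type} [Field k]

/-- The exponent of the pure monomial `X₂^i X₃^j`. -/
theorem single_two_add_single_three_apply (i j : ℕ) (t : Fin 4) :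
    (Finsupp.single (2 : Fin 4) i + Finsupp.single (3 : Fin 4) j) t = if t = 2 then i else if t = 3 then j else 0 := by
  fin_cases t <;> simp

/-- **Coefficients of a sum of CONSTANT multiples of pure monomials `X₂^(e 0) X₃^(e 1)`** at a pure exponent. -/
theorem coeff_sum_C_mul_X_pow (T : Finset (Fin 2 →₀ ℕ)) (β : (Fin 2 →₀ ℕ) → k) (m : Fin 4 →₀ ℕ) (hm0 : m 0 = 0) (hm1 : m 1 = 0) :
    coeff m (∑ e ∈ T, C (β e) * (X 2 ^ (e 0) * X 3 ^ (e 1)) : MvPowerSeries (Fin 4) k) =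
      if Finsupp.single (0 : Fin 2) (m 2) + Finsupp.single 1 (m 3) ∈ T then
        β (Finsupp.single (0 : Fin 2) (m 2) + Finsupp.single 1 (m 3)) else 0 := by
  classical
  have hmono : ∀ e : Fin 2 →₀ ℕ, (C (β e) * (X 2 ^ (e 0) * X 3 ^ (e 1)) : MvPowerSeries (Fin 4) k) =
      monomial (Finsupp.single 2 (e 0) + Finsupp.single 3 (e 1)) (β e) := by
    intro e
    rw [X_pow_eq, X_pow_eq, monomial_mul_monomial, one_mul]
    ext n
    rw [coeff_C_mul, coeff_monomial, coeff_monomial]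
    split_ifs <;> simp
  simp_rw [hmono, map_sum, coeff_monomial]
  -- the exponent `m` is hit by `e` iff `e = (m 2, m 3)`
  have hiff : ∀ e : Fin 2 →₀ ℕ, (m = Finsupp.single 2 (e 0) + Finsupp.single 3 (e 1)) ↔
      e = Finsupp.single (0 : Fin 2) (m 2) + Finsupp.single 1 (m 3) := by
    intro e
    constructor
    · intro h
      ext t
      fin_cases t
      · have := congrArg (fun f => f 2) h; simp at this; simp [this]
      · have := congrArg (fun f => f 3) h; simp at this; simp [this]
    · intro h
      subst h
      ext t
      fin_cases t <;> simp [hm0, hm1]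
  simp_rw [hiff]
  rw [Finset.sum_ite_eq']

/-- … and it VANISHES at every exponent involving `X₀` or `X₁`. -/
theorem coeff_sum_C_mul_X_pow_of_ne (T : Finset (Fin 2 →₀ ℕ)) (β : (Fin 2 →₀ ℕ) → k) (m : Fin 4 →₀ ℕ)
    (hm : m 0 ≠ 0 ∨ m 1 ≠ 0) :
    coeff m (∑ e ∈ T, C (β e) * (X 2 ^ (e 0) * X 3 ^ (e 1)) : MvPowerSeries (Fin 4) k) = 0 := by
  classical
  have hmono : ∀ e : Fin 2 →₀ ℕ, (C (β e) * (X 2 ^ (e 0) * X 3 ^ (e 1)) : MvPowerSeries (Fin 4) k) =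
      monomial (Finsupp.single 2 (e 0) + Finsupp.single 3 (e 1)) (β e) := by
    intro e
    rw [X_pow_eq, X_pow_eq, monomial_mul_monomial, one_mul]
    ext n
    rw [coeff_C_mul, coeff_monomial, coeff_monomial]
    split_ifs <;> simp
  simp_rw [hmono, map_sum, coeff_monomial]
  refine Finset.sum_eq_zero fun e _ => if_neg ?_
  intro h
  rcases hm with h0 | h1
  · exact h0 (by rw [h]; simp)
  · exact h1 (by rw [h]; simp)

/-- **Degree bound of a sum of constant multiples of pure monomials of degree `d`.** -/
theorem degBound_sum_C_mul_X_pow (T : Finset (Fin 2 →₀ ℕ)) (β : (Fin 2 →₀ ℕ) → k) (d : ℕ)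
    (hT : ∀ e ∈ T, e 0 + e 1 = d) :
    ∀ m : Fin 4 →₀ ℕ, m 0 = 0 → coeff m (∑ e ∈ T, C (β e) * (X 2 ^ (e 0) * X 3 ^ (e 1)) : MvPowerSeries (Fin 4) k) ≠ 0 →
      m 2 + m 3 ≤ d := by
  intro m hm0 hne
  by_cases hm1 : m 1 = 0
  · rw [coeff_sum_C_mul_X_pow T β m hm0 hm1] at hne
    by_cases hmem : Finsupp.single (0 : Fin 2) (m 2) + Finsupp.single 1 (m 3) ∈ T
    · have := hT _ hmem
      simp at this
      omega
    · exact absurd (if_neg hmem) hne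
  · exact absurd (coeff_sum_C_mul_X_pow_of_ne T β m (Or.inr hm1)) hne

end PureCoeff
end Summit.ResolutionOfSingularities.ResolutionOfSingularities.Theorems.SwitchingDichotomy.HatBaseChange

end
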